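import Mathlib

/-!
# Cube-shell adjacency of nearest-neighbour Fourier coupling, and the cube-tail Poincaré sentence (cap g5, cell `ns-blowup`, 2026-08-26)

HONEST FRAMING (human ruling D-0035): nothing here is a claim about Navier–Stokes blow-up.
WHAT THIS IS NOT: not NS evidence. Two lattice sentences of the D2-3L-X0 inequality chain
(`cap/D2-CHAIN-MAP.md`) that were paper-grade, typed over `k : d → ℤ` with the sup-norm written
coordinatewise (no new definitions):

* step S3 «`T = ℙ[(U·∇)· + (·∇)U]` with `U`'s Fourier support in `{|q|_∞ ≤ 1}` maps the cube shell
  `|k|_∞ = j` into the shells `j − 1, j, j + 1`»: the support of a product is contained in the sumset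
  of the supports, and for `|q|_∞ ≤ 1`, `|p|_∞ = j` one has `j − 1 ≤ |p + q|_∞ ≤ j + 1`
  (`forall_abs_add_le_of_unit`, `exists_abs_add_ge_of_unit`; hence a block-TRIDIAGONAL head matrix
  in the shell ordering, refuter2 K-note l.1727 «nearest-neighbour only»);
* step S7 (c), third instantiation sentence «cube tail `|k|_∞ ≥ K + 1 ⇒ |k| ≥ K + 1`» (the
  Poincaré constant `(K+1)²` used for the tail fields): `sq_le_sum_sq_of_exists_abs_ge` —
  if some coordinate has `|kᵢ| ≥ K + 1` then `(K+1)² ≤ ∑ᵢ kᵢ²`; and its converse direction for the head,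
  `sum_sq_le_card_mul_sq_of_forall_abs_le` — `|k|_∞ ≤ K ⇒ ∑ᵢ kᵢ² ≤ d·K²`.

Mathlib only; no new definitions.
-/

namespace Summit.NavierStokesRegularity.FluidComputer.CubeShellAdjacency

variable {d : Type*}

/-- **Upper adjacency.** If every coordinate of `q` has `|qᵢ| ≤ 1` and every coordinate of `p` has
`|pᵢ| ≤ j`, then every coordinate of `p + q` has `|(p+q)ᵢ| ≤ j + 1`: nearest-neighbour coupling
raises the cube shell by at most one. -/
theorem forall_abs_add_le_of_unit {p q : d → ℤ} {j : ℤ} (hq : ∀ i, |q i| ≤ 1)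
    (hp : ∀ i, |p i| ≤ j) : ∀ i, |(p + q) i| ≤ j + 1 := by
  intro i
  have h := abs_add_le (p i) (q i)
  simp only [Pi.add_apply]
  linarith [hq i, hp i]

/-- **Lower adjacency.** If every coordinate of `q` has `|qᵢ| ≤ 1` and SOME coordinate of `p` has
`j ≤ |pᵢ|`, then some coordinate of `p + q` has `j − 1 ≤ |(p+q)ᵢ|`: nearest-neighbour coupling
lowers the cube shell by at most one. -/
theorem exists_abs_add_ge_of_unit {p q : d → ℤ} {j : ℤ} (hq : ∀ i, |q i| ≤ 1)
    (hp : ∃ i, j ≤ |p i|) : ∃ i, j - 1 ≤ |(p + q) i| := by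
  obtain ⟨i, hi⟩ := hp
  refine ⟨i, ?_⟩
  have h := abs_sub_abs_le_abs_add (p i) (q i)
  simp only [Pi.add_apply]
  linarith [hq i]

/-- **The three-shell window.** With `|q|_∞ ≤ 1` and `p` EXACTLY on the cube shell `j`
(`|pᵢ| ≤ j` for all `i`, `= j` for some `i`), `p + q` lies in the window `j − 1 ≤ |p+q|_∞ ≤ j + 1`:
all coordinates `≤ j + 1` and some coordinate `≥ j − 1`. This is the adjacency sentence of
D2-CHAIN-MAP step S3 (block-tridiagonal head in the shell ordering). -/
theorem shell_window_of_unit {p q : d → ℤ} {j : ℤ} (hq : ∀ i, |q i| ≤ 1)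
    (hp : ∀ i, |p i| ≤ j) (hpj : ∃ i, |p i| = j) :
    (∀ i, |(p + q) i| ≤ j + 1) ∧ ∃ i, j - 1 ≤ |(p + q) i| :=
  ⟨forall_abs_add_le_of_unit hq hp,
    exists_abs_add_ge_of_unit hq (hpj.imp fun _ h => h.ge)⟩

/-- The same window for `p − q` (the coupling `k → k − e`), since `|−qᵢ| = |qᵢ|`. -/
theorem shell_window_sub_of_unit {p q : d → ℤ} {j : ℤ} (hq : ∀ i, |q i| ≤ 1)
    (hp : ∀ i, |p i| ≤ j) (hpj : ∃ i, |p i| = j) :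
    (∀ i, |(p - q) i| ≤ j + 1) ∧ ∃ i, j - 1 ≤ |(p - q) i| := by
  have hq' : ∀ i, |(-q) i| ≤ 1 := fun i => by simpa using hq i
  simpa [sub_eq_add_neg] using shell_window_of_unit (q := -q) hq' hp hpj

section Euclidean

variable [Fintype d]

/-- **Cube tail ⇒ Euclidean tail** (D2-CHAIN-MAP S7 (c)): if some coordinate satisfies
`K + 1 ≤ |kᵢ|` (i.e. `|k|_∞ ≥ K + 1`) then `(K + 1)² ≤ ∑ᵢ kᵢ²` (i.e. `|k| ≥ K + 1`), so the tail
fields beyond the cube shell `K` obey the Poincaré inequality with constant `(K+1)²`. -/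
theorem sq_le_sum_sq_of_exists_abs_ge {k : d → ℤ} {K : ℤ} (hK : 0 ≤ K + 1)
    (h : ∃ i, K + 1 ≤ |k i|) : (K + 1) ^ 2 ≤ ∑ i, k i ^ 2 := by
  obtain ⟨i, hi⟩ := h
  have h1 : (K + 1) ^ 2 ≤ k i ^ 2 := by
    calc (K + 1) ^ 2 ≤ |k i| ^ 2 := pow_le_pow_left₀ hK hi 2
      _ = k i ^ 2 := sq_abs _
  exact h1.trans (Finset.single_le_sum (f := fun i => k i ^ 2) (fun i _ => sq_nonneg (k i))
    (Finset.mem_univ i))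

/-- The real-cast form used against `ν|k|²`: `((K:ℝ) + 1)² ≤ ∑ᵢ (kᵢ : ℝ)²` under the same
hypothesis. -/
theorem sq_le_sum_sq_of_exists_abs_ge_real {k : d → ℤ} {K : ℕ}
    (h : ∃ i, (K : ℤ) + 1 ≤ |k i|) : ((K : ℝ) + 1) ^ 2 ≤ ∑ i, ((k i : ℤ) : ℝ) ^ 2 := by
  have hz := sq_le_sum_sq_of_exists_abs_ge (k := k) (K := (K : ℤ)) (by positivity) h
  have e : (((K : ℤ) + 1) ^ 2 : ℤ) = (((K + 1) ^ 2 : ℕ) : ℤ) := by push_cast; ring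
  have hcast : (((K : ℝ) + 1) ^ 2) = ((((K : ℤ) + 1) ^ 2 : ℤ) : ℝ) := by push_cast; ring
  rw [hcast]
  have hsum : ((∑ i, k i ^ 2 : ℤ) : ℝ) = ∑ i, ((k i : ℤ) : ℝ) ^ 2 := by push_cast; rfl
  rw [← hsum]
  exact_mod_cast hz

/-- **Head bound** (converse direction, for the head shells): `|kᵢ| ≤ K` for all `i` gives
`∑ᵢ kᵢ² ≤ card d · K²`. -/
theorem sum_sq_le_card_mul_sq_of_forall_abs_le {k : d → ℤ} {K : ℤ}
    (h : ∀ i, |k i| ≤ K) : ∑ i, k i ^ 2 ≤ (Fintype.card d : ℤ) * K ^ 2 := by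
  calc ∑ i, k i ^ 2 ≤ ∑ _i : d, K ^ 2 := by
        refine Finset.sum_le_sum fun i _ => ?_
        calc k i ^ 2 = |k i| ^ 2 := (sq_abs _).symm
          _ ≤ K ^ 2 := pow_le_pow_left₀ (abs_nonneg _) (h i) 2
    _ = (Fintype.card d : ℤ) * K ^ 2 := by simp [Finset.sum_const, Finset.card_univ]

end Euclidean

end Summit.NavierStokesRegularity.FluidComputer.CubeShellAdjacency
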